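import Summits.QuantumFields.BalabanUV.T4Continuum.Support.NE7LandauExactSup
import Summits.QuantumFields.BalabanUV.T4Continuum.Support.NE7LandauLinearStraight
import Summits.QuantumFields.BalabanUV.T4Continuum.Support.NE7GaugeStepDeviation
import Summits.QuantumFields.BalabanUV.T4Continuum.Support.NE3CovariantCalculus
import HarnessLib

/-!
# NE7TopLandauGradient — ROAD v4, piece T5: the LINK GRADIENT of `log W` in the EXACT top Landau gauge from the covariant plaquette current,
# via lit-balaban's IS gradient letter and absorption of the `δ`-suppressed BCH-remainder term (G7's binder `hr₁`)

Cell `pub-balaban`, rung (B)+1 sub-cell t4, lineage `b2b-balaban-t4-ne7-p1`, generation 74 (CRUX PROVER NE7 #1, OWNER row NE7).  Memo `REP-FLAT-ROAD-v4.md` §4.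
After D4 (`NE7TopLandauGauge.exists_top_landau_gauge_flatTop`: a unitary periodic `u₀` with `W := U^{u₀}` `r`-close to `1` on links, `log W` EXACTLY
`(1 − P_c^T)∂*`-gauged entrywise, straight datum `≤ q`), the second binder of G7 `NE7ApeTrivialFlatEndLinks.smallField_of_trivialLetters_links` wants the link
GRADIENT `‖W(y + e_τ, κ) − W(y, κ)‖ = O(δ∕M²)`.  This file proves it from ONE more datum, the covariant plaquette CURRENT
`J_W(x, κ) := Σ_ν cDstar W ν (W(∂p_{νκ}) − 1) x` (the object R4 `NE7CovDivB8Letter` identifies with [B8] (1.2) and bounds at a tangent-critical configuration).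

WHAT ([folklore]; 0 def, 0 sorry; every dimension `d + 1`).
§1 **`norm_linCurrent_sub_covCurrent_le`** (T5a, the CURRENT DICTIONARY): for `W = e^{A}` unitary with `‖W − 1‖ ≤ r` on links, plaquettes `ε`-small, `‖A‖ ≤ ρ` and an
   a priori link-gradient bound `G`, at every bond `(x, κ)`: `‖Σ_ν [curl♭A(x − e_ν; ν, κ) − curl♭A(x; ν, κ)] − J_W(x, κ)‖ ≤ (d+1)·(2rε + (e^{4ρ} − 1)·4G)` — per `ν` the
   difference is `−(Ad_{W⁻¹} − 1)(W(∂p) − 1)` (`≤ 2rε`, `norm_Ad_sub_le`) minus the difference of the two BCH plaquette remainders `W(∂p) − 1 − curl♭A(p)` at `p_{νκ}(x − e_ν)`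
   and `p_{νκ}(x)`, translates of each other, Lipschitz in the four link differences (`NE7GradientCurrency.norm_plaqRem_sub_plaqRem_le`).
§2 **`half_curlAdjCurl_entry`**: on the fine torus `(n₀N)^{d+1}` with lit-balaban's normalisation `η⁻¹ = n₀`, for the torus restriction `z` of an entry of a periodic `A`:
   `(½∂ᴴ∂z)(t, κ) = n₀²·(Σ_μ [curl♭A(rep t − e_μ; μ, κ) − curl♭A(rep t; μ, κ)])_{ii′}` (`NE7LandauLinearSup.half_curlAdjCurl_eq_sum_fdiffH`, `fdiff_conjTranspose_mulVec`,
   `NE7TorusBoxDictionary.curlAt_flat_entry_torus`).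
§3 **`exists_exact_gradient_const`** (T5b): `∃ K > 0` (`= card n ·` the constant of `NE7LandauExactSup.exists_exact_grad_const`; depends on `d` only) such that for every
   `n₀, N`, every unitary `(n₀N)`-periodic `W` with links `‖W − 1‖ ≤ r ≤ 1∕8`, plaquettes `≤ ε`, `log W` exactly gauged entrywise, straight datum `≤ q`, current `‖J_W‖ ≤ j`,
   under the ONE smallness line `K(d+1)·n₀·(e^{8r} − 1) ≤ 1∕8`:  `‖log W(y + e_τ, κ) − log W(y, κ)‖ ≤ 2K·(n₀(j + (d+1)·2rε) + q∕n₀)` and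
   `‖W(y + e_τ, κ) − W(y, κ)‖ ≤ 4K·(n₀(j + (d+1)·2rε) + q∕n₀)` at every link and direction — IS gradient letter entrywise with `B″ = n₀²·(j + §1) + q`, matrix norm by
   `opNorm_le_card_mul`, the `G`-term `4K(d+1)n₀(e^{8r} − 1)·G ≤ G∕2` absorbed by iteration from the a priori `G₀ = 4r`.
   With D4's `r = C₀Mε`, `q = C₂Mε` (`n₀ = M`, `δ = M²ε`): smallness `≈ 8KC₀(d+1)δ ≤ 1∕8`, gradient `= O(Mj + δε + ε) = O(δ∕M²)` iff `j = O(δ∕M³)` — R4's (1.9) size.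

HONEST FRAMING (page 1): T5 of ROAD v4 — a LETTER (the current `j` is a hypothesis; its size `O(δ∕M³)` at a tangent-critical block-flat configuration is R4
`NE7CovDivB8Letter.norm_covDiv_le_of_tanCritical` + the (160) docking, not this file); REP♭⁻∕REP♭ NOT proved here; (APE) NOT proved; NOT NE7; spine 0∕9; finite T⁴
rung (B)+1 — NOT infinite volume, NOT mass gap, NOT Clay.  Continuum YM on T⁴ ⇐ BetaPertH ∧ nine spine estimates (0/9 proved); BetaPertH ⇐ (D1) ∧ (D4) ∧ CAP+tail.
-/

set_option autoImplicit false

open scoped BigOperators Matrix Matrix.Norms.L2Operator ComplexConjugate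
open NormedSpace Finset

namespace Summit.QuantumFields.BalabanUV.T4Continuum.NE7TopLandauGradient

open Literature.MathematicalPhysics.QuantumFieldTheory.Balaban1983to89
open B7Prop1Explicit B7Prop2Explicit MatrixLog
open T4AveragingDeficitWall (Ad IsUnitaryCfg SmallField vary curlAt)
open T4AveragingDeficitWallBoundary (IsPeriodicCfg)
open AveragingDeficitPeriodicCounting (IsPeriodicDir)
open AveragingDeficitNearIdentity (norm_Ad_sub_le)
open BlockAveragePushDirSplit (flat)
open NE3SmoothLiftCurl (curlAt_flat_eq)
open NE3CovariantCalculus (cDstar)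
open NE7GradientCurrency (hol_vary_flat_plaqWord norm_plaqRem_sub_plaqRem_le vary_flat_one_apply)
open NE7GaugeStepLetters (norm_exp_sub_exp_le_two_mul)
open B5Prop11Plancherel (Tor fine unitVec fdiff)
open B5Action121 (Fs GradOp CurlOp)
open B5Block118 (QvOp)
open B5DeltaA169 (QvAdj)
open B5Value126 (PcT)
open B5G183FreeRowSum (fdiff_mulVec fdiff_conjTranspose_mulVec)
open B6LowerBound2153Torus (toT rep toT_rep)
open NE7TorusBoxDictionary (curlAt_flat_entry_torus toT_add_e' apply_rep_toT')
open NE7FlatHkOrthogonal (Fs_eq_mul_Fs_one)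
open NE7FlatHkCurlLetter (opNorm_le_card_mul)
open NE7LandauLinearSup (half_curlAdjCurl_eq_sum_fdiffH)
open NE7LandauExactSup (exists_exact_grad_const)
open NE7LandauLinearStraight (norm_QvAdj_mulVec_le)
open Literature.Computability.QuantumComplexity.SolovayKitaev (norm_apply_le_norm)

noncomputable section

variable {d : ℕ} {n : Type*} [Fintype n] [DecidableEq n]

/-! ## §1 The current dictionary: linear (flat) current of `A` versus covariant plaquette current of `W = e^{A}` -/

section Current

/-- **T5a, THE CURRENT DICTIONARY.**  For `W = e^{A}` unitary with links `‖W − 1‖ ≤ r`, plaquettes `ε`-small, `‖A‖ ≤ ρ` and an a priori bound `G` on all link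
differences of `A`: at every bond `(x, κ)` the flat lattice current `Σ_ν [curl♭A(x − e_ν; ν, κ) − curl♭A(x; ν, κ)]` is within `(d+1)·(2rε + (e^{4ρ} − 1)·4G)` of the
covariant plaquette current `Σ_ν cDstar W ν (W(∂p_{νκ}) − 1) x`. [folklore] -/
theorem norm_linCurrent_sub_covCurrent_le [Nonempty n] {W : Site (d + 1) → Fin (d + 1) → (Matrix n n ℂ)ˣ} (hWu : IsUnitaryCfg W)
    {ε : ℝ} (hε : 0 ≤ ε) (hWε : SmallField W ε)
    {A : Site (d + 1) → Fin (d + 1) → Matrix n n ℂ} (hWA : ∀ (y : Site (d + 1)) (κ : Fin (d + 1)), ((W y κ : (Matrix n n ℂ)ˣ) : Matrix n n ℂ) = exp (A y κ))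
    {ρ : ℝ} (hA : ∀ (y : Site (d + 1)) (κ : Fin (d + 1)), ‖A y κ‖ ≤ ρ)
    {r : ℝ} (hr : ∀ (y : Site (d + 1)) (κ : Fin (d + 1)), ‖((W y κ : (Matrix n n ℂ)ˣ) : Matrix n n ℂ) - 1‖ ≤ r)
    {G : ℝ} (hG : ∀ (y : Site (d + 1)) (κ τ : Fin (d + 1)), ‖A (y + e τ) κ - A y κ‖ ≤ G) (x : Site (d + 1)) (κ : Fin (d + 1)) :
    ‖(∑ ν : Fin (d + 1), (curlAt (flat (d := d + 1) (n := n)) A (x - e ν) ν κ - curlAt (flat (d := d + 1) (n := n)) A x ν κ))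
        - ∑ ν : Fin (d + 1), cDstar W ν (fun w => ((hol W w (plaqWord ν κ) : (Matrix n n ℂ)ˣ) : Matrix n n ℂ) - 1) x‖
      ≤ ((d + 1 : ℕ) : ℝ) * (2 * r * ε + (Real.exp (4 * ρ) - 1) * (4 * G)) := by
  letI : CStarAlgebra (Matrix n n ℂ) := {}
  have hρ0 : 0 ≤ ρ := (norm_nonneg _).trans (hA 0 0)
  have hr0 : 0 ≤ r := (norm_nonneg _).trans (hr 0 0)
  have hexp0 : 0 ≤ Real.exp (4 * ρ) - 1 := by linarith [Real.add_one_le_exp (4 * ρ)]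
  have hgW : vary (flat (d := d + 1) (n := n)) A 1 = W := by
    funext y μ; apply Units.ext; rw [vary_flat_one_apply, val_expUnit, hWA]
  -- the plaquette of `W` at `w` in the plane `(ν, κ)` as a four-factor product, and its deviation
  have hPexp : ∀ (w : Site (d + 1)) (ν : Fin (d + 1)), ((hol W w (plaqWord ν κ) : (Matrix n n ℂ)ˣ) : Matrix n n ℂ)
      = exp (A w ν) * exp (A (w + e ν) κ) * exp (-A (w + e κ) ν) * exp (-A w κ) := fun w ν => by
    rw [← hgW, hol_vary_flat_plaqWord]
  have hdev : ∀ (w : Site (d + 1)) (ν : Fin (d + 1)), ‖((hol W w (plaqWord ν κ) : (Matrix n n ℂ)ˣ) : Matrix n n ℂ) - 1‖ ≤ ε := by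
    intro w ν
    by_cases hνκ : ν = κ
    · subst hνκ
      rw [B7Prop1Local.hol_plaqWord_eq, mul_inv_cancel_right, mul_inv_cancel, Units.val_one, sub_self, norm_zero]
      exact hε
    · exact hWε w ν κ hνκ
  have hcurl : ∀ (w : Site (d + 1)) (ν : Fin (d + 1)),
      curlAt (flat (d := d + 1) (n := n)) A w ν κ = A w ν + A (w + e ν) κ + -A (w + e κ) ν + -A w κ := fun w ν => by
    rw [curlAt_flat_eq]; abel
  -- per direction `ν`
  have hν : ∀ ν : Fin (d + 1),
      ‖(curlAt (flat (d := d + 1) (n := n)) A (x - e ν) ν κ - curlAt (flat (d := d + 1) (n := n)) A x ν κ)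
          - cDstar W ν (fun w => ((hol W w (plaqWord ν κ) : (Matrix n n ℂ)ˣ) : Matrix n n ℂ) - 1) x‖
        ≤ 2 * r * ε + (Real.exp (4 * ρ) - 1) * (4 * G) := by
    intro ν
    set X : Matrix n n ℂ := ((hol W (x - e ν) (plaqWord ν κ) : (Matrix n n ℂ)ˣ) : Matrix n n ℂ) - 1 with hX
    set Y : Matrix n n ℂ := ((hol W x (plaqWord ν κ) : (Matrix n n ℂ)ˣ) : Matrix n n ℂ) - 1 with hY
    have hcD : cDstar W ν (fun w => ((hol W w (plaqWord ν κ) : (Matrix n n ℂ)ˣ) : Matrix n n ℂ) - 1) x = Ad (W (x - e ν) ν)⁻¹ X - Y := rfl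
    -- the transport term
    have hu : (W (x - e ν) ν)⁻¹ ∈ unitaryUnits (Matrix n n ℂ) := (unitaryUnits (Matrix n n ℂ)).inv_mem (hWu _ ν)
    have hui : ‖(((W (x - e ν) ν)⁻¹ : (Matrix n n ℂ)ˣ) : Matrix n n ℂ) - 1‖ ≤ r := by
      have hn1 : ‖(((W (x - e ν) ν)⁻¹ : (Matrix n n ℂ)ˣ) : Matrix n n ℂ)‖ = 1 := CStarRing.norm_of_mem_unitary (mem_unitaryUnits.mp hu)
      have hfac : (((W (x - e ν) ν)⁻¹ : (Matrix n n ℂ)ˣ) : Matrix n n ℂ) - 1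
          = (((W (x - e ν) ν)⁻¹ : (Matrix n n ℂ)ˣ) : Matrix n n ℂ) * (1 - ((W (x - e ν) ν : (Matrix n n ℂ)ˣ) : Matrix n n ℂ)) := by
        rw [mul_sub, mul_one, Units.inv_mul]
      rw [hfac]
      calc _ ≤ ‖(((W (x - e ν) ν)⁻¹ : (Matrix n n ℂ)ˣ) : Matrix n n ℂ)‖ * ‖1 - ((W (x - e ν) ν : (Matrix n n ℂ)ˣ) : Matrix n n ℂ)‖ := norm_mul_le _ _
        _ ≤ 1 * r := by rw [hn1, norm_sub_rev]; exact (one_mul _).le.trans ((hr _ ν).trans (one_mul r).symm.le)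
        _ = r := one_mul r
    have hT : ‖Ad (W (x - e ν) ν)⁻¹ X - X‖ ≤ 2 * r * ε := by
      calc ‖Ad (W (x - e ν) ν)⁻¹ X - X‖ ≤ 2 * ‖(((W (x - e ν) ν)⁻¹ : (Matrix n n ℂ)ˣ) : Matrix n n ℂ) - 1‖ * ‖X‖ := norm_Ad_sub_le hu X
        _ ≤ 2 * r * ε := mul_le_mul (mul_le_mul_of_nonneg_left hui (by norm_num)) (hdev _ ν) (norm_nonneg _) (by positivity)
    -- the two remainders
    have hrem := norm_plaqRem_sub_plaqRem_le (𝔸 := Matrix n n ℂ)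
      (x₁ := A (x - e ν) ν) (x₂ := A (x - e ν + e ν) κ) (x₃ := -A (x - e ν + e κ) ν) (x₄ := -A (x - e ν) κ)
      (y₁ := A x ν) (y₂ := A (x + e ν) κ) (y₃ := -A (x + e κ) ν) (y₄ := -A x κ) (ρ := ρ)
      (hA _ ν) (hA _ κ) (by rw [norm_neg]; exact hA _ ν) (by rw [norm_neg]; exact hA _ κ)
      (hA x ν) (hA _ κ) (by rw [norm_neg]; exact hA _ ν) (by rw [norm_neg]; exact hA x κ)
    have h4 : ‖A (x - e ν) ν - A x ν‖ + ‖A (x - e ν + e ν) κ - A (x + e ν) κ‖ + ‖-A (x - e ν + e κ) ν - -A (x + e κ) ν‖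
        + ‖-A (x - e ν) κ - -A x κ‖ ≤ 4 * G := by
      have e1 : ‖A (x - e ν) ν - A x ν‖ ≤ G := by
        have h := hG (x - e ν) ν ν; rw [sub_add_cancel] at h; rwa [norm_sub_rev]
      have e2 : ‖A (x - e ν + e ν) κ - A (x + e ν) κ‖ ≤ G := by
        have h := hG x κ ν; rw [sub_add_cancel, norm_sub_rev]; exact h
      have e3 : ‖-A (x - e ν + e κ) ν - -A (x + e κ) ν‖ ≤ G := by
        have h := hG (x - e ν + e κ) ν ν
        rw [show x - e ν + e κ + e ν = x + e κ by abel] at h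
        rw [show -A (x - e ν + e κ) ν - -A (x + e κ) ν = A (x + e κ) ν - A (x - e ν + e κ) ν by abel]; exact h
      have e4 : ‖-A (x - e ν) κ - -A x κ‖ ≤ G := by
        have h := hG (x - e ν) κ ν; rw [sub_add_cancel] at h
        rw [show -A (x - e ν) κ - -A x κ = A x κ - A (x - e ν) κ by abel]; exact h
      linarith
    have hsplit : (curlAt (flat (d := d + 1) (n := n)) A (x - e ν) ν κ - curlAt (flat (d := d + 1) (n := n)) A x ν κ)
          - cDstar W ν (fun w => ((hol W w (plaqWord ν κ) : (Matrix n n ℂ)ˣ) : Matrix n n ℂ) - 1) x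
        = -(Ad (W (x - e ν) ν)⁻¹ X - X)
          - ((exp (A (x - e ν) ν) * exp (A (x - e ν + e ν) κ) * exp (-A (x - e ν + e κ) ν) * exp (-A (x - e ν) κ) - 1
                - (A (x - e ν) ν + A (x - e ν + e ν) κ + -A (x - e ν + e κ) ν + -A (x - e ν) κ))
              - (exp (A x ν) * exp (A (x + e ν) κ) * exp (-A (x + e κ) ν) * exp (-A x κ) - 1
                - (A x ν + A (x + e ν) κ + -A (x + e κ) ν + -A x κ))) := by
      rw [hcD, hcurl, hcurl, ← hPexp, ← hPexp]
      simp only [hX, hY]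
      abel
    rw [hsplit]
    refine (norm_sub_le _ _).trans (add_le_add (by rw [norm_neg]; exact hT) (hrem.trans ?_))
    exact mul_le_mul_of_nonneg_left h4 hexp0
  rw [← Finset.sum_sub_distrib]
  calc _ ≤ ∑ ν : Fin (d + 1), (2 * r * ε + (Real.exp (4 * ρ) - 1) * (4 * G)) := norm_sum_le_of_le _ fun ν _ => hν ν
    _ = ((d + 1 : ℕ) : ℝ) * (2 * r * ε + (Real.exp (4 * ρ) - 1) * (4 * G)) := by
        rw [Finset.sum_const, Finset.card_univ, Fintype.card_fin, nsmul_eq_mul]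

end Current

/-! ## §2 The torus identity: `½∂ᴴ∂z` of an entry restriction is `n₀²` times the flat lattice current, entrywise -/

section Torus

/-- **`½∂ᴴ∂z = n₀²·(flat current)`, ENTRYWISE ON THE TORUS** (`η⁻¹ = n₀`): for the torus restriction `z` of the entry `(i, i′)` of an `(n₀N)`-periodic `A`,
`(½∂ᴴ∂z)(t, κ) = n₀²·(Σ_μ [curl♭A(rep t − e_μ; μ, κ) − curl♭A(rep t; μ, κ)])_{ii′}`. [folklore] -/
theorem half_curlAdjCurl_entry (n₀ N : ℕ) [NeZero n₀] [NeZero N] {A : Site (d + 1) → Fin (d + 1) → Matrix n n ℂ}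
    (hAP : IsPeriodicDir A ((n₀ * N : ℕ) : ℤ)) (i i' : n) (t : Tor (fine n₀ (fun _ : Fin (d + 1) => N))) (κ : Fin (d + 1)) :
    ((1 / 2 : ℂ) • (((CurlOp (fine n₀ (fun _ : Fin (d + 1) => N)) (n₀ : ℂ))ᴴ * CurlOp (fine n₀ (fun _ : Fin (d + 1) => N)) (n₀ : ℂ)) *ᵥ
        fun p : Tor (fine n₀ (fun _ : Fin (d + 1) => N)) × Fin (d + 1) => A (rep (fine n₀ (fun _ : Fin (d + 1) => N)) p.1) p.2 i i')) (t, κ)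
      = (n₀ : ℂ) * (n₀ : ℂ) *
          (∑ μ : Fin (d + 1), (curlAt (flat (d := d + 1) (n := n)) A (rep (fine n₀ (fun _ : Fin (d + 1) => N)) t - e μ) μ κ
            - curlAt (flat (d := d + 1) (n := n)) A (rep (fine n₀ (fun _ : Fin (d + 1) => N)) t) μ κ)) i i' := by
  haveI : NeZero (n₀ * N) := ⟨Nat.mul_ne_zero (NeZero.ne n₀) (NeZero.ne N)⟩
  rw [half_curlAdjCurl_eq_sum_fdiffH, Finset.sum_apply, Matrix.sum_apply, Finset.mul_sum]
  refine Finset.sum_congr rfl fun μ _ => ?_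
  rw [fdiff_conjTranspose_mulVec, Complex.conj_natCast, Matrix.sub_apply]
  dsimp only
  have hsub : toT (fine n₀ (fun _ : Fin (d + 1) => N)) (rep (fine n₀ (fun _ : Fin (d + 1) => N)) t - e μ)
      = t - unitVec (fine n₀ (fun _ : Fin (d + 1) => N)) μ := by
    have h := toT_add_e' (fine n₀ (fun _ : Fin (d + 1) => N)) (rep (fine n₀ (fun _ : Fin (d + 1) => N)) t - e μ) μ
    rw [sub_add_cancel, toT_rep] at h
    exact eq_sub_of_add_eq h.symm
  have h1 := curlAt_flat_entry_torus (P := n₀ * N) hAP (rep (fine n₀ (fun _ : Fin (d + 1) => N)) t - e μ) μ κ i i'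
  have h0 := curlAt_flat_entry_torus (P := n₀ * N) hAP (rep (fine n₀ (fun _ : Fin (d + 1) => N)) t) μ κ i i'
  rw [hsub] at h1
  rw [toT_rep] at h0
  simp only [Fs_eq_mul_Fs_one _ ((n₀ : ℂ))]
  rw [← h1, ← h0]
  ring

end Torus

/-! ## §3 The gradient in the exact gauge -/

section Gradient

/-- **T5b, THE LINK GRADIENT IN THE EXACT TOP LANDAU GAUGE.**  `∃ K > 0` (on `d` and `card n`) such that for every `n₀, N`, every unitary `(n₀N)`-periodic `W`
with links `‖W − 1‖ ≤ r ≤ 1∕8`, plaquettes `ε`-small, `log W` EXACTLY `(1 − P_c^T)∂*`-gauged entrywise on the fine torus (`η⁻¹ = n₀`), straight datum `≤ q` and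
covariant plaquette current `‖Σ_ν cDstar W ν (W(∂p_{νκ}) − 1) x‖ ≤ j`, under the smallness `K(d+1)·n₀·(e^{8r} − 1) ≤ 1∕8`: every link difference obeys
`‖log W(y + e_τ, κ) − log W(y, κ)‖ ≤ 2K(n₀(j + (d+1)·2rε) + q∕n₀)` and `‖W(y + e_τ, κ) − W(y, κ)‖ ≤ 4K(n₀(j + (d+1)·2rε) + q∕n₀)`. [folklore] -/
theorem exists_exact_gradient_const [Nonempty n] :
    ∃ K : ℝ, 0 < K ∧ ∀ (n₀ N : ℕ) [NeZero n₀] [NeZero N] (W : Site (d + 1) → Fin (d + 1) → (Matrix n n ℂ)ˣ) (ε r q j : ℝ),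
      IsUnitaryCfg W → IsPeriodicCfg W ((n₀ * N : ℕ) : ℤ) → 0 ≤ ε → SmallField W ε →
      (∀ (y : Site (d + 1)) (κ : Fin (d + 1)), ‖((W y κ : (Matrix n n ℂ)ˣ) : Matrix n n ℂ) - 1‖ ≤ r) → r ≤ 1 / 8 →
      (∀ i i' : n, (1 - PcT n₀ (fun _ : Fin (d + 1) => N) (n₀ : ℂ)) *ᵥ ((GradOp (fine n₀ (fun _ : Fin (d + 1) => N)) (n₀ : ℂ))ᴴ *ᵥ
        fun p : Tor (fine n₀ (fun _ : Fin (d + 1) => N)) × Fin (d + 1) =>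
          mlog ((W (rep (fine n₀ (fun _ : Fin (d + 1) => N)) p.1) p.2 : (Matrix n n ℂ)ˣ) : Matrix n n ℂ) i i') = 0) →
      (∀ (i i' : n) (t : Tor (fun _ : Fin (d + 1) => N)) (κ : Fin (d + 1)),
        ‖(QvOp n₀ (fun _ : Fin (d + 1) => N) *ᵥ fun p : Tor (fine n₀ (fun _ : Fin (d + 1) => N)) × Fin (d + 1) =>
          mlog ((W (rep (fine n₀ (fun _ : Fin (d + 1) => N)) p.1) p.2 : (Matrix n n ℂ)ˣ) : Matrix n n ℂ) i i') (t, κ)‖ ≤ q) →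
      (∀ (x : Site (d + 1)) (κ : Fin (d + 1)),
        ‖∑ ν : Fin (d + 1), cDstar W ν (fun w => ((hol W w (plaqWord ν κ) : (Matrix n n ℂ)ˣ) : Matrix n n ℂ) - 1) x‖ ≤ j) →
      K * ((d + 1 : ℕ) : ℝ) * (n₀ : ℝ) * (Real.exp (8 * r) - 1) ≤ 1 / 8 →
      (∀ (y : Site (d + 1)) (κ τ : Fin (d + 1)),
          ‖mlog ((W (y + e τ) κ : (Matrix n n ℂ)ˣ) : Matrix n n ℂ) - mlog ((W y κ : (Matrix n n ℂ)ˣ) : Matrix n n ℂ)‖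
            ≤ 2 * K * ((n₀ : ℝ) * (j + ((d + 1 : ℕ) : ℝ) * (2 * r * ε)) + q / (n₀ : ℝ))) ∧
      (∀ (y : Site (d + 1)) (κ τ : Fin (d + 1)),
          ‖((W (y + e τ) κ : (Matrix n n ℂ)ˣ) : Matrix n n ℂ) - ((W y κ : (Matrix n n ℂ)ˣ) : Matrix n n ℂ)‖
            ≤ 4 * K * ((n₀ : ℝ) * (j + ((d + 1 : ℕ) : ℝ) * (2 * r * ε)) + q / (n₀ : ℝ))) := by
  letI : CStarAlgebra (Matrix n n ℂ) := {}
  obtain ⟨C, hC, hIS⟩ := exists_exact_grad_const (d := d)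
  refine ⟨Fintype.card n * C, by positivity, fun n₀ N _ _ W ε r q j hWu hWP hε hWε hr hr8 hgauge hq hj hsmall => ?_⟩
  haveI : NeZero (n₀ * N) := ⟨Nat.mul_ne_zero (NeZero.ne n₀) (NeZero.ne N)⟩
  have hn₀ : (0 : ℝ) < n₀ := by exact_mod_cast Nat.pos_of_ne_zero (NeZero.ne n₀)
  have hr0 : 0 ≤ r := (norm_nonneg _).trans (hr 0 0)
  have hD0 : (0 : ℝ) ≤ ((d + 1 : ℕ) : ℝ) := Nat.cast_nonneg _
  have hj0 : 0 ≤ j := (norm_nonneg _).trans (hj 0 0)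
  have hexp0 : 0 ≤ Real.exp (8 * r) - 1 := by linarith [Real.add_one_le_exp (8 * r)]
  -- abbreviations
  set T : Fin (d + 1) → ℕ := fine n₀ (fun _ : Fin (d + 1) => N) with hT
  set A : Site (d + 1) → Fin (d + 1) → Matrix n n ℂ := fun y κ => mlog ((W y κ : (Matrix n n ℂ)ˣ) : Matrix n n ℂ) with hAdef
  set K₀ : ℝ := Fintype.card n * C * ((n₀ : ℝ) * (j + ((d + 1 : ℕ) : ℝ) * (2 * r * ε)) + q / (n₀ : ℝ)) with hK₀
  have hWA : ∀ (y : Site (d + 1)) (κ : Fin (d + 1)), ((W y κ : (Matrix n n ℂ)ˣ) : Matrix n n ℂ) = exp (A y κ) := fun y κ =>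
    (exp_mlog ((hr y κ).trans_lt (by linarith))).symm
  have hAn : ∀ (y : Site (d + 1)) (κ : Fin (d + 1)), ‖A y κ‖ ≤ 2 * r := fun y κ =>
    (norm_mlog_le_two_mul ((hr y κ).trans (by linarith))).trans (by linarith [hr y κ])
  have hAP : IsPeriodicDir A ((n₀ * N : ℕ) : ℤ) := fun y ι κ => by simp only [hAdef, hWP y ι κ]
  have hq0 : 0 ≤ q := (norm_nonneg _).trans (hq (Classical.arbitrary n) (Classical.arbitrary n) 0 0)
  -- ONE IMPROVEMENT STEP: an a priori gradient bound `G` improves to `K₀ + G/2`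
  have step : ∀ G : ℝ, (∀ (y : Site (d + 1)) (κ τ : Fin (d + 1)), ‖A (y + e τ) κ - A y κ‖ ≤ G) →
      ∀ (y : Site (d + 1)) (κ τ : Fin (d + 1)), ‖A (y + e τ) κ - A y κ‖ ≤ K₀ + G / 2 := by
    intro G hG y κ τ
    -- the source bound `B″ = n₀²·S + q`, `S = j + (d+1)(2rε + (e^{8r} − 1)·4G)`
    set S : ℝ := j + ((d + 1 : ℕ) : ℝ) * (2 * r * ε + (Real.exp (4 * (2 * r)) - 1) * (4 * G)) with hS
    have hcur : ∀ (x : Site (d + 1)) (κ' : Fin (d + 1)),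
        ‖∑ ν : Fin (d + 1), (curlAt (flat (d := d + 1) (n := n)) A (x - e ν) ν κ' - curlAt (flat (d := d + 1) (n := n)) A x ν κ')‖ ≤ S := by
      intro x κ'
      have h := norm_linCurrent_sub_covCurrent_le hWu hε hWε hWA hAn hr hG x κ'
      have h2 := norm_le_norm_add_norm_sub'
        (∑ ν : Fin (d + 1), (curlAt (flat (d := d + 1) (n := n)) A (x - e ν) ν κ' - curlAt (flat (d := d + 1) (n := n)) A x ν κ'))
        (∑ ν : Fin (d + 1), cDstar W ν (fun w => ((hol W w (plaqWord ν κ') : (Matrix n n ℂ)ˣ) : Matrix n n ℂ) - 1) x)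
      rw [hS]
      linarith [hj x κ']
    have hent : ∀ i i' : n, ‖(A (y + e τ) κ - A y κ) i i'‖ ≤ C * ((n₀ : ℝ) * S + q / (n₀ : ℝ)) := by
      intro i i'
      set z : Tor T × Fin (d + 1) → ℂ := fun p => A (rep T p.1) p.2 i i' with hz
      have hB : ∀ p : Tor T × Fin (d + 1), ‖((1 / 2 : ℂ) • (((CurlOp T (n₀ : ℂ))ᴴ * CurlOp T (n₀ : ℂ)) *ᵥ z)
          + (QvAdj n₀ (fun _ : Fin (d + 1) => N) * QvOp n₀ (fun _ : Fin (d + 1) => N)) *ᵥ z) p‖ ≤ (n₀ : ℝ) * (n₀ : ℝ) * S + q := by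
        intro p
        obtain ⟨t, κ'⟩ := p
        rw [Pi.add_apply]
        refine (norm_add_le _ _).trans (add_le_add ?_ ?_)
        · rw [hz, half_curlAdjCurl_entry n₀ N hAP i i' t κ', norm_mul, norm_mul, Complex.norm_natCast]
          refine mul_le_mul_of_nonneg_left ((norm_apply_le_norm _ i i').trans (hcur _ κ')) (by positivity)
        · rw [← Matrix.mulVec_mulVec]
          exact norm_QvAdj_mulVec_le n₀ (fun _ : Fin (d + 1) => N) _ (fun b => hq i i' b.1 b.2) _
      have h := hIS n₀ (fun _ : Fin (d + 1) => N) z (hgauge i i') _ hB τ (toT T y, κ)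
      rw [fdiff_mulVec, norm_mul, Complex.norm_natCast] at h
      simp only [hz] at h
      rw [← toT_add_e', apply_rep_toT' (P := n₀ * N) hAP (y + e τ) κ, apply_rep_toT' (P := n₀ * N) hAP y κ] at h
      rw [Matrix.sub_apply]
      have key : (n₀ : ℝ) * (C * ((n₀ : ℝ) * S + q / (n₀ : ℝ))) = C * ((n₀ : ℝ) * (n₀ : ℝ) * S + q) := by
        field_simp
      exact le_of_mul_le_mul_left (h.trans (le_of_eq key.symm)) hn₀
    have hmat : ‖A (y + e τ) κ - A y κ‖ ≤ Fintype.card n * (C * ((n₀ : ℝ) * S + q / (n₀ : ℝ))) := opNorm_le_card_mul _ hent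
    have hG0 : 0 ≤ G := (norm_nonneg _).trans (hG 0 0 0)
    have hsplit : Fintype.card n * (C * ((n₀ : ℝ) * S + q / (n₀ : ℝ)))
        = K₀ + (4 * (Fintype.card n * C * ((d + 1 : ℕ) : ℝ) * (n₀ : ℝ) * (Real.exp (8 * r) - 1))) * G := by
      rw [hK₀, hS, show (4 : ℝ) * (2 * r) = 8 * r by ring]; ring
    rw [hsplit] at hmat
    have hcoef : (4 * (Fintype.card n * C * ((d + 1 : ℕ) : ℝ) * (n₀ : ℝ) * (Real.exp (8 * r) - 1))) * G ≤ G / 2 := by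
      have h1 : 4 * (Fintype.card n * C * ((d + 1 : ℕ) : ℝ) * (n₀ : ℝ) * (Real.exp (8 * r) - 1)) ≤ 1 / 2 := by linarith
      have := mul_le_mul_of_nonneg_right h1 hG0
      linarith
    linarith
  -- ITERATION from the a priori bound `G₀ = 4r`
  have hG₀ : ∀ (y : Site (d + 1)) (κ τ : Fin (d + 1)), ‖A (y + e τ) κ - A y κ‖ ≤ 4 * r := fun y κ τ =>
    (norm_sub_le _ _).trans (by linarith [hAn (y + e τ) κ, hAn y κ])
  have hiter : ∀ m : ℕ, ∀ (y : Site (d + 1)) (κ τ : Fin (d + 1)), ‖A (y + e τ) κ - A y κ‖ ≤ 2 * K₀ + 4 * r / 2 ^ m := by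
    intro m
    induction m with
    | zero =>
        intro y κ τ
        have hK₀0 : 0 ≤ K₀ := by rw [hK₀]; positivity
        have := hG₀ y κ τ
        rw [pow_zero, div_one]; linarith
    | succ m ih =>
        intro y κ τ
        have h := step _ ih y κ τ
        rw [pow_succ]
        have : (2 * K₀ + 4 * r / 2 ^ m) / 2 = K₀ + 4 * r / (2 ^ m * 2) := by
          field_simp
        linarith
  have hlog : ∀ (y : Site (d + 1)) (κ τ : Fin (d + 1)), ‖A (y + e τ) κ - A y κ‖ ≤ 2 * K₀ := by
    intro y κ τ
    refine le_of_forall_pos_lt_add fun η hη => ?_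
    obtain ⟨m, hm⟩ := exists_nat_gt (4 * r / η)
    have h2m : (m : ℝ) < (2 : ℝ) ^ m := by exact_mod_cast Nat.lt_two_pow_self
    have hpos : (0 : ℝ) < 2 ^ m := by positivity
    have hlt : 4 * r / 2 ^ m < η := by
      rw [div_lt_iff₀ hpos]
      have := (div_lt_iff₀ hη).mp hm
      nlinarith
    linarith [hiter m y κ τ]
  have hK₀eq : 2 * K₀ = 2 * (Fintype.card n * C) * ((n₀ : ℝ) * (j + ((d + 1 : ℕ) : ℝ) * (2 * r * ε)) + q / (n₀ : ℝ)) := by rw [hK₀]; ring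
  refine ⟨fun y κ τ => ?_, fun y κ τ => ?_⟩
  · have h := hlog y κ τ
    rw [hK₀eq] at h
    exact h
  · rw [hWA, hWA]
    have h := hlog y κ τ
    rw [hK₀eq] at h
    calc ‖exp (A (y + e τ) κ) - exp (A y κ)‖ ≤ 2 * ‖A (y + e τ) κ - A y κ‖ :=
          norm_exp_sub_exp_le_two_mul ((hAn _ κ).trans (by linarith)) ((hAn y κ).trans (by linarith))
      _ ≤ 2 * (2 * (Fintype.card n * C) * ((n₀ : ℝ) * (j + ((d + 1 : ℕ) : ℝ) * (2 * r * ε)) + q / (n₀ : ℝ))) := by linarith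
      _ = 4 * (Fintype.card n * C) * ((n₀ : ℝ) * (j + ((d + 1 : ℕ) : ℝ) * (2 * r * ε)) + q / (n₀ : ℝ)) := by ring

end Gradient

end

end Summit.QuantumFields.BalabanUV.T4Continuum.NE7TopLandauGradient
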